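import Literature.AlgebraicGeometry.HodgeTheory.SymbolClasses
import HarnessLib

/-!
# Classes transgressed from Čech cocycles of a Zariski open cover are algebraic (Bloch–Ogus)

Topic `Literature/AlgebraicGeometry/HodgeTheory`. One NAMED FACT (D-0014),
`blochOgus1974_zariskiTransgression_algebraic`, recording the following consequence of the
theory of Bloch–Ogus (the arithmetic / coniveau filtration is the Leray filtration of
`X^an → X_Zar`). In particular the symbol classes of Milnor symbol cocycles of REGULAR units on a
finite ZARISKI open cover — the image of `Ȟᵖ(𝔙, 𝒦^M_p) → Hᵖ(X_Zar, 𝒦^M_p) ≅ CHᵖ(X) → H²ᵖ` — are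
algebraic; the statement recorded is the coarser one in which neither the units nor the Milnor
`K`-sheaf appear, only the Zariski cover.

Mathematics. Let `X` be a smooth complex algebraic variety, `α : X^an → X_Zar` the continuous
identity map, and `Nᵃ Hᵏ(X^an; ℂ) = ⋃_{Z} Ker (Hᵏ(X^an; ℂ) → Hᵏ((X ∖ Z)^an; ℂ))`, `Z ⊆ X` closed
of codimension `≥ a`, Grothendieck's filtration by coniveau. Bloch–Ogus (1974), Prop. (6.4): for
the de Rham theory in characteristic zero the coniveau spectral sequence is isomorphic from `E₂`
on with the second spectral sequence of hypercohomology `E₂^{a,b} = Hᵃ(X_Zar, ℋᵇ) ⇒ H^{a+b}(X)`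
of the de Rham complex, and over `k = ℂ` both coincide with the Leray spectral sequence
`E₂^{a,b} = Hᵃ(X_Zar, Rᵇα_* ℂ) ⇒ H^{a+b}(X^an; ℂ)` (Grothendieck's comparison theorem:
`Ω^•_X → α_* Ω^•_{X^an}` computes `Rα_* ℂ`); Cor. (6.9) (answering Washnitzer): the filtration
this spectral sequence induces on `Hᵏ(X^an; ℂ)`, the Leray filtration
`Lᵃ Hᵏ = Im (Hᵏ(X_Zar, τ_{≤ k-a} Rα_* ℂ) → Hᵏ(X^an; ℂ))`, IS the filtration by coniveau `Nᵃ Hᵏ`.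
Consequence (Čech version). Let `𝔙 = (V_i)` be a Zariski open cover of `X` and `𝔘 = (V_i^an)`
the analytic open cover of `X^an` it defines. The Čech–de Rham double complex
`K^{a,b} = Cᵃ(𝔘, 𝒜ᵇ)` of `𝔘` (Bott–Tu §8; all ordered tuples) is literally the Čech double complex
`Cᵃ(𝔙, α_* 𝒜ᵇ_ℂ)` of the ZARISKI cover `𝔙` with coefficients in the complex `α_* 𝒜^•_ℂ` of
direct images of the sheaves of smooth complex forms, which represents `Rα_* ℂ` (fine sheaves are
`α_*`-acyclic) and consists of sheaves acyclic on every Zariski open; hence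
`H_D(K) = H^*(X_Zar, Rα_* ℂ) = H^*(X^an; ℂ)`, the identification being the one of Bott–Tu,
Prop. 8.8 (restriction `r : 𝒜^•(X^an) → K^{0,•}`). A `D`-cocycle of total degree `k` with
components only in Čech degrees `≥ a` has its leading component in `Cᵃ(𝔙, Z^{k-a})`, i.e. it is
a cocycle of the Čech complex of `𝔙` with coefficients in the truncation `τ_{≤ k-a} α_* 𝒜^•`; by
the natural map from the Čech cohomology of a cover to hypercohomology (Godement, II §5.9), its
class lies in `Lᵃ Hᵏ(X^an; ℂ) = Nᵃ Hᵏ(X^an; ℂ)`. For `k = 2p`, `a = p`: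
`Nᵖ H²ᵖ(X^an; ℂ)` is the `ℂ`-span of the classes supported on closed subsets of codimension
`≥ p`, the tree's `algebraicClasses X p` (for `X` smooth projective the span of the cycle classes;
Bloch–Ogus (7.2), (7.6)). In the tree's language (`Literature/Geometry/Kaehler/
CechDeRhamTransgression`, `IsTransgression`: the zig-zag of the proof of Bott–Tu Prop. 8.8, which
exhibits `r θ` as `D`-cohomologous to `± w` with `w ∈ K^{q+1,q+1}`): if `θ` is a Čech–de Rham
transgression of ANY Čech `(q+1)`-cochain `w` of `(q+1)`-forms with respect to the analytic open
cover `U_i = (A.toComplexPoints)⁻¹(V_i(ℂ))` of a Hodge model `A` of `X` defined by Zariski opens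
`V_i` (the `U_i` covering `X^an`), then every class `c ∈ H^{2q+2}(X(ℂ); ℂ)` with
`A.deRham [θ] = m • A^* c`, `m ≠ 0`, lies in `algebraicClasses X (q + 1)`. (Naturality of the
de Rham comparison `A.deRham` for open inclusions transports the kernels of restriction maps; a
natural comparison differs from integration by a scalar in each degree, which does not move a
`ℂ`-subspace; no rationality of `c` is needed since `Nᵖ H²ᵖ(X^an; ℂ)` is a `ℂ`-subspace.)

The special case that motivates the record (line `NashDescentSketch` of the crux
`SymbolClassesAlgebraic`, route `MilnorKExponential` of `HodgeConjecture`, step (W_alg)): `w_J` the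
symbol forms `Σ n · dlog s₁ ∧ ⋯ ∧ dlog s_p` of a Milnor symbol `p`-cocycle whose units `s_k` are
regular functions on `V_J` — a Čech cocycle of the Zariski cover `𝔙` with values in the Milnor
`K`-sheaf `𝒦^M_p` (Kerz 2009: the Gersten resolution of `𝒦^M_p` and Bloch's formula
`Hᵖ(X_Zar, 𝒦^M_p) ≅ CHᵖ(X)`; Bloch, Lecture 4, Cor. 4.20 for Quillen's `𝒦_p`; Bloch–Ogus (7.4),
(7.6): `Hᵖ(X_Zar, ℋᵖ) ≅ Aᵖ(X) ⊗`, cycles modulo algebraic equivalence; Esnault 1990 §§1–3 for the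
analytic `𝒦₂` and its cycle map): its transgressed class is the complexified class of a
codimension-`p` cycle. The coarser statement recorded here needs no `K`-theory: only the cover is
Zariski. Sharpness: FALSE for an arbitrary ANALYTIC open cover in place of `𝔘 = 𝔙^an` (for a good
cover of `X^an` every class of `H^{2q+2}(X^an; ℂ)`, e.g. a class of type `(2q+2, 0)`, is such a
transgression, the columns of the Čech–de Rham complex of a good cover being exact as well); and
FALSE without the covering hypothesis (the bottom of the zig-zag only determines `θ` on `⋃ U_i`).

Vocabulary (nothing is redefined): the tree's `HodgeModel` (`A.carrier = X^an`,
`A.toComplexPoints`, `A.deRham`, `A.pullback`), `IsTransgression`, `cclosedSmoothForms`,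
`complexDeRhamCohomology.mk`, `complexBetti`, `algebraicClasses`, `Motives.IsSmoothProjective`;
Zariski opens are `V i : X.left.Opens` and `{P | P.pt ∈ V i}` is `V_i(ℂ) ⊆ X(ℂ)`. Consumer: the
support file `Theorems/MilnorKExponentialSymbolClassesAlgebraicNashHighBand.lean` of the summit
`HodgeConjecture` (the band `3 ≤ q + 1 ≤ n - 2` of stub (W_alg): a rational Nash symbol class that
becomes, after a base change of non-zero degree, a Zariski transgression is algebraic). Not here:
sheaf cohomology on `X_Zar`, the sheaves `ℋᵇ`, `𝒦^M_p`, the coniveau and Leray spectral sequences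
themselves (the tree has no carrier for them), and the finer integral statement through `CHᵖ`.

## References

* [BlochOgus1974ENS] S. Bloch, A. Ogus, Gersten's conjecture and the homology of schemes, Ann. Sci.
  ÉNS (4) 7 (1974), 181–201: Prop. (6.4), Cor. (6.9), (7.2), Cor. (7.4), Remark (7.6).
* [Grothendieck1966deRham] A. Grothendieck, On the de Rham cohomology of algebraic varieties, Publ.
  Math. IHÉS 29 (1966), Thm. 1'.
* [BottTu1982Forms] R. Bott, L. W. Tu, Differential Forms in Algebraic Topology (1982), §8,
  Prop. 8.5, Prop. 8.8 and its proof, Thm. 8.9.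
* [Godement1958] R. Godement, Topologie algébrique et théorie des faisceaux (1958), II §5.9
  (Čech cohomology of a cover → cohomology).
* [Kerz2009GerstenMilnorK] M. Kerz, The Gersten conjecture for Milnor K-theory, Invent. Math. 175
  (2009), 1–33, Thm. 1.1 and the Bloch formula.
* [BlochLectures2010] S. Bloch, Lectures on Algebraic Cycles, 2nd ed. (2010), Lecture 4,
  (4.16)–(4.20).
* [Esnault1990CycleMap] H. Esnault, A note on the cycle map, J. reine angew. Math. 411 (1990), §§1–3.
* [GrothendieckTopology1969] A. Grothendieck, Hodge's general conjecture is false for trivial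
  reasons, Topology 8 (1969), §1 (the filtration by coniveau).
-/

noncomputable section

open scoped Manifold ContDiff
open CategoryTheory AlgebraicGeometry

namespace Literature.AlgebraicGeometry.HodgeTheory

open Literature.Geometry.Kaehler Literature.NumberTheory.Transcendental

section HodgeTheory

/-- **Classes transgressed from Čech cocycles of a ZARISKI open cover are algebraic** (named
fact; Bloch–Ogus). Let `X` be a smooth projective complex variety and `α : X^an → X_Zar` the
identity. Bloch–Ogus (1974), Prop. (6.4) and Cor. (6.9): the Leray spectral sequence
`E₂^{a,b} = Hᵃ(X_Zar, Rᵇα_* ℂ) ⇒ H^{a+b}(X^an; ℂ)` coincides from `E₂` on with the coniveau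
spectral sequence, and the filtration it induces on `Hᵏ(X^an; ℂ)` — the Leray filtration
`Lᵃ Hᵏ = Im Hᵏ(X_Zar, τ_{≤ k-a} Rα_* ℂ)` — is Grothendieck's filtration by coniveau
`Nᵃ Hᵏ = ⋃_{codim Z ≥ a} Ker (Hᵏ(X^an) → Hᵏ((X ∖ Z)^an))` (as Washnitzer had asked). For a
Zariski open cover `𝔙 = (V_i)` of `X`, the Čech–de Rham double complex `Cᵃ(𝔘, 𝒜ᵇ)` (Bott–Tu §8)
of the analytic cover `𝔘 = 𝔙^an` is the Čech double complex of `𝔙` with coefficients in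
`α_* 𝒜^•_ℂ ≃ Rα_* ℂ`, so a `D`-cocycle of total degree `2p` concentrated in Čech degrees `≥ p`
— whose leading component is a Čech `p`-cochain of CLOSED `p`-forms, i.e. which lies in the Čech
complex of `𝔙` with coefficients in `τ_{≤ p} α_* 𝒜^•` — has its class (Čech cohomology of a
cover maps to hypercohomology, Godement II §5.9; `H_D = H_dR(X^an)`, Bott–Tu Prop. 8.8) in
`Lᵖ H²ᵖ(X^an; ℂ) = Nᵖ H²ᵖ(X^an; ℂ)`, the `ℂ`-span of the classes supported in codimension `p`,
which is `algebraicClasses X p` (for `X` smooth projective the span of cycle classes, Bloch–Ogus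
(7.2), (7.6)). Statement (tree vocabulary; `p = q + 1`): for a Hodge model `A` of `X`, Zariski
opens `V_i` whose analytic opens `U_i = (A.toComplexPoints)⁻¹(V_i(ℂ))` cover `X^an`, ANY Čech
`(q+1)`-cochain `w` of `(q+1)`-forms and a closed `(2q+2)`-form `θ` reached from `w` by the
zig-zag of the proof of Bott–Tu Prop. 8.8 (`IsTransgression`: `r θ` is `D`-cohomologous to `± w`),
every class `c ∈ H^{2q+2}(X(ℂ); ℂ)` with `A.deRham [θ] = m • A^* c` for an integer `m ≠ 0` lies
in `algebraicClasses X (q + 1)` (complex coefficients: no rationality of `c` is needed; the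
natural comparison `A.deRham` is compatible with restriction to the opens `(X ∖ Z)^an`). In
particular (the case of the Milnor-`K` route of the Hodge summit) the symbol classes
`Σ n · dlog s₁ ∧ ⋯ ∧ dlog s_p` of Milnor symbol cocycles of REGULAR units `s_k ∈ Γ(V_J, 𝒪_X)ˣ`
of a Zariski cover are algebraic — the image of `Ȟᵖ(𝔙, 𝒦^M_p) → Hᵖ(X_Zar, 𝒦^M_p) ≅ CHᵖ(X)`
(Kerz 2009, Bloch's formula for the Milnor `K`-sheaf) under the cycle class map.
[cite: BlochOgus1974ENS, Prop. (6.4), Cor. (6.9), (7.2) and Remark (7.6)]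
[cite: Grothendieck1966deRham, Thm. 1']
[cite: BottTu1982Forms, §8 Prop. 8.8 (and its proof) and Thm. 8.9]
[cite: Godement1958, II §5.9] -/
def blochOgus1974_zariskiTransgression_algebraic : Prop :=
  ∀ ⦃n : ℕ⦄ ⦃X : Motives.SchemeOver ℂ⦄, Motives.IsSmoothProjective n X →
    ∀ (A : HodgeModel n X) (q : ℕ) ⦃ι : Type⦄ (V : ι → X.left.Opens) (U : ι → Set A.carrier)
      (hU : ∀ i, IsOpen (U i)),
      (∀ i, U i = A.toComplexPoints ⁻¹' {P | P.pt ∈ V i}) → (∀ x, ∃ i, x ∈ U i) →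
      ∀ (w : (Fin (q + 2) → ι) → MForm 𝓘(ℝ, A.model) A.carrier ℂ (q + 1))
        (θ : cclosedSmoothForms A.model A.carrier (2 * q + 1 + 1)) (m : ℤ)
        (c : complexBetti X (2 * (q + 1))),
        IsTransgression hU q w θ → m ≠ 0 →
        A.deRham A.carrier (2 * q + 1 + 1)
            (complexDeRhamCohomology.mk A.model A.carrier (2 * q + 1 + 1) θ) =
          (m : ℂ) • A.pullback (2 * q + 1 + 1) c →
        c ∈ algebraicClasses X (q + 1)

-- TODO(general form): Bloch–Ogus prove the identification of the whole coniveau spectral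
-- sequence with the Leray spectral sequence of `X^an → X_Zar` from `E₂` on (and `E₂ = Hᵃ(ℋᵇ)`,
-- `Hᵃ(X_Zar, ℋᵇ) = 0` for `a > b`), for every smooth complex variety and every bidegree; recorded
-- here is the one inclusion `(Čech filtration of a Zariski cover)ᵖ H²ᵖ ⊆ Nᵖ H²ᵖ` in the shape
-- the consumer needs (the tree has no sheaf cohomology on the Zariski site to phrase more).

end HodgeTheory

end Literature.AlgebraicGeometry.HodgeTheory

end
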